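import Summits.HodgeConjecture.HodgeConjecture.Theorems.F0P3cStCharTSHleviCosets          -- ★ p849792 KIT-B (LH6-p04 (g3)): `hc_of_cosetSum` — the `horient` binder shape; brings `endoEmbLocal`, `IsLocalGRegular`
import Summits.HodgeConjecture.HodgeConjecture.Theorems.F0P3cStCharTSShellOrientation     -- ★ p849755 ORIENT: `not_v_ray_last_lt_fst`, `v_flip_snd_lt_flip_fst`, `diagonal_three_pow`
import Literature.NumberTheory.Rogawski1990.LocalNormFibreSurjectiveNonsplit              -- ★ `coe_localNonsplitEquiv_eq_map` (`E₃ g = (matrix of g).map ev_w`, definitional)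
import Literature.NumberTheory.Rogawski1990.FinExplicitTransferFactorLeviStratum          -- ★ `endoEmbLocal_eq_glDiagonal_of_fst_eq` (`ι_v(diag(d′₀,d′₁), u) = diag(d′₀, u, d′₁)`)
import Literature.NumberTheory.EllipticCurves.OpenImageMazurRaynaudValuationProofs       -- ★ `Mazur1978.v_eq_one_of_v_sub_one_lt` (principal units have valuation `1`; reused, not restated)
import HarnessLib

/-!
# F0 · P3c · line LH6 «StCharTS» — road (D), (D-c) brick «HORIENT★»: KIT-B's `horient` clause — the ANTI-oriented shell `b·C`, `b = z·𝓘.a^m`, never meets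
# the `hlevi` stratum  [Rogawski1990, §4.9 Lemma 4.9.2, (4.9.4) p. 56; §12.7 L. 12.7.3 (proof) p. 195]

Cell `pub/hodgecm-mathlib`, crux H413 = `stmt-HodgeConjecture-24833` (lane `--supports … --as helper`), route HCCMUnconditional; seat LH1-p03 (g2) as extra hands of
road (D), DEAL «HORIENT★» of the road owner LH6-p04 (g3) 2026-09-02T06:29:24Z.  THEOREMS ONLY (no definition, no instance, no notation, no named fact, no `sorry`);
★-only imports.  HONEST LABEL: HC_CM is proved only modulo the 7 printed citations (2 remaining: hLiu418 = stmt-HodgeConjecture-24832, h413 = stmt-HodgeConjecture-24833)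
until rung 0 closes; count-neutral plumbing of road (D) (the `horient` input of ★ `hc_of_cosetSum`).

THE MATHEMATICS.  `v` non-split in `L/L⁺`, `w` the place above it, `E₃ = localNonsplitEquiv … w hw : U(Φ₃)(L⁺_v) ≃ U(σ_w, Φ₃)(L_w)` the one-place model (its matrix is the
`w`-component of the `∏_{w∣v} L_w`-matrix, ★ `coe_localNonsplitEquiv_eq_map`).  XIG binders: `K_n ≤ U(Φ₃)(L⁺_v)` of LEVEL `r < 1` at `w` (`|E₃(k)ᵢⱼ − δᵢⱼ|_w ≤ r`), a central
`z` with `E₃ z = β·1`, `|β|_w = 1`, the contracting `a` with `E₃ a = diag(α, 1, (σ_w α)⁻¹)`, `α ≠ 0`, `|α|_w < 1`, `m ≥ 1`, `b = z a^m`.  A point of the anti-oriented shell is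
`t = b·s`, `s ∈ K_n`; its `E₃`-diagonal is `(β αᵐ k₀₀, β k₁₁, β (σ_w α)⁻ᵐ k₂₂)` with `|kᵢᵢ|_w = 1` (`|kᵢᵢ − 1|_w ≤ r < 1`, ★ `Mazur1978.v_eq_one_of_v_sub_one_lt`; §1).  On the `hlevi` stratum `t = ι_v(γ_H)`,
`γ_H = (diag(d′₀, d′₁), u)`, so the `∏ L_w`-matrix of `t` is `diag(d′₀, u′, d′₁)` (★ `endoEmbLocal_eq_glDiagonal_of_fst_eq`) and `E₃(t)₀₀ = (d′₀)_w`, `E₃(t)₂₂ = (d′₁)_w` (§1).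
Hence `|(d′₁)_w| = |α|^{-m} > |α|^{m} = |(d′₀)_w|`, contradicting the stratum's side condition `hlt : |(d′₁)_w| < |(d′₀)_w|` — ORIENT's ★ `not_v_ray_last_lt_fst` (§2
`valued_not_lt_of_endoEmbLocal_eq_ray_mul`, and `horient_antiShell` in the exact binder shape of ★ `hc_of_cosetSum`).  Twin sanity (§2, not load-bearing): on the Weyl-flipped
shell `E₃ b₂ = diag(β(σ_w α)⁻ᵐ, β, β αᵐ)` the side condition HOLDS (★ `v_flip_snd_lt_flip_fst`).

## References
* [Rogawski1990] J. D. Rogawski, *Automorphic Representations of Unitary Groups in Three Variables*, Ann. of Math. Stud. 123 (1990): §4.9 Lemma 4.9.2, (4.9.4) p. 56;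
  §12.7 Lemma 12.7.3 (proof) p. 195 (the shells `K_n z a^m K_n` on `M⁻`).
* [Casselman1995] W. Casselman, *Introduction to the theory of admissible representations of 𝔭-adic reductive groups* (1995 notes), §1.4 (the contracting element).
-/

set_option autoImplicit false
-- the mandated namespace has the single-problem summit's repeated segment (`HodgeConjecture.HodgeConjecture`)
set_option linter.dupNamespace false

noncomputable section

open Matrix NumberField IsDedekindDomain
open scoped MatrixGroups
open Literature.NumberTheory.Rogawski1990 Literature.NumberTheory.Automorphic Literature.NumberTheory.Automorphic.UnitaryGroup
open Literature.NumberTheory.GaloisRepresentations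

namespace Summit.HodgeConjecture.HodgeConjecture.Cruxes.H413.F0P3cStCharTSHorient

/-! ## §1 `E₃`-coordinates at a non-split place: level subgroups, the ray `z·a^m·s`, the `hlevi` stratum -/

section CM

variable (L : Type) [Field L] [NumberField L] [IsCMField L] (v : HeightOneSpectrum (𝓞 ↥(maximalRealSubfield L)))
  (w : PlacesOver L v) (hw : IsCMField.complexConj L • w.1 = w.1)

/-- **Diagonal entries of a level-`r` element are `w`-units**: `k ∈ K_n`, `|E₃(k)ᵢⱼ − δᵢⱼ|_w ≤ r < 1` ⟹ `|E₃(k)ᵢᵢ|_w = 1`. [cite: Rogawski1990, §4.9 p. 56; §12.7 L. 12.7.3 (proof) p. 195] -/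
theorem valued_diag_eq_one_of_mem_level
    (Kn : Subgroup ↥(unitaryGroupOfForm (conjLocal L (IsCMField.complexConj L) v) (cmLocalForm L 3 v))) {r : WithZero (Multiplicative ℤ)} (hr : r < 1)
    (hK : ∀ k ∈ Kn, ∀ i j, Valued.v ((((localNonsplitEquiv (IsCMField.complexConj L) (qsForm L) (IsCMField.complexConj_ne_one L) w hw k :
        ↥(unitaryGroupOfForm (galAdicCompletionMap (L := L) (IsCMField.complexConj L) hw) (placeForm (qsForm L) w.1))) :
        GL (Fin 3) (w.1.adicCompletion L)) : Matrix (Fin 3) (Fin 3) (w.1.adicCompletion L)) i j - (1 : Matrix (Fin 3) (Fin 3) (w.1.adicCompletion L)) i j) ≤ r)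
    {k : ↥(unitaryGroupOfForm (conjLocal L (IsCMField.complexConj L) v) (cmLocalForm L 3 v))} (hk : k ∈ Kn) (i : Fin 3) :
    Valued.v ((((localNonsplitEquiv (IsCMField.complexConj L) (qsForm L) (IsCMField.complexConj_ne_one L) w hw k :
        ↥(unitaryGroupOfForm (galAdicCompletionMap (L := L) (IsCMField.complexConj L) hw) (placeForm (qsForm L) w.1))) :
        GL (Fin 3) (w.1.adicCompletion L)) : Matrix (Fin 3) (Fin 3) (w.1.adicCompletion L)) i i) = 1 := by
  have h := hK k hk i i
  rw [Matrix.one_apply_eq] at h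
  exact Literature.NumberTheory.EllipticCurves.Mazur1978.v_eq_one_of_v_sub_one_lt (lt_of_le_of_lt h hr)

/-- **`E₃`-DIAGONAL OF THE RAY `z·a^m·s`**: with `E₃ z = β·1`, `E₃ a = diag(α, 1, (σ_w α)⁻¹)`: `E₃(z a^m s)ᵢᵢ = β · (αᵐ, 1, (σ_w α)⁻ᵐ)ᵢ · E₃(s)ᵢᵢ` (`E₃` multiplicative,
`diag(α,1,β')^m = diag(αᵐ,1,β'ᵐ)` ★ `diagonal_three_pow`, `(diag d · S)ᵢⱼ = dᵢ Sᵢⱼ`). [cite: Rogawski1990, §12.7 L. 12.7.3 (proof) p. 195] [cite: Casselman1995, §1.4] -/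
theorem localNonsplitEquiv_ray_mul_apply
    {z a : ↥(unitaryGroupOfForm (conjLocal L (IsCMField.complexConj L) v) (cmLocalForm L 3 v))} {β α : w.1.adicCompletion L}
    (hz : (((localNonsplitEquiv (IsCMField.complexConj L) (qsForm L) (IsCMField.complexConj_ne_one L) w hw z :
        ↥(unitaryGroupOfForm (galAdicCompletionMap (L := L) (IsCMField.complexConj L) hw) (placeForm (qsForm L) w.1))) :
        GL (Fin 3) (w.1.adicCompletion L)) : Matrix (Fin 3) (Fin 3) (w.1.adicCompletion L)) = β • (1 : Matrix (Fin 3) (Fin 3) (w.1.adicCompletion L)))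
    (ha : (((localNonsplitEquiv (IsCMField.complexConj L) (qsForm L) (IsCMField.complexConj_ne_one L) w hw a :
        ↥(unitaryGroupOfForm (galAdicCompletionMap (L := L) (IsCMField.complexConj L) hw) (placeForm (qsForm L) w.1))) :
        GL (Fin 3) (w.1.adicCompletion L)) : Matrix (Fin 3) (Fin 3) (w.1.adicCompletion L)) =
        Matrix.diagonal ![α, 1, ((galAdicCompletionMap (L := L) (IsCMField.complexConj L) hw) α)⁻¹])
    (m : ℕ) (s : ↥(unitaryGroupOfForm (conjLocal L (IsCMField.complexConj L) v) (cmLocalForm L 3 v))) (i : Fin 3) :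
    (((localNonsplitEquiv (IsCMField.complexConj L) (qsForm L) (IsCMField.complexConj_ne_one L) w hw (z * a ^ m * s) :
        ↥(unitaryGroupOfForm (galAdicCompletionMap (L := L) (IsCMField.complexConj L) hw) (placeForm (qsForm L) w.1))) :
        GL (Fin 3) (w.1.adicCompletion L)) : Matrix (Fin 3) (Fin 3) (w.1.adicCompletion L)) i i =
      β * (![α ^ m, 1, ((galAdicCompletionMap (L := L) (IsCMField.complexConj L) hw) α)⁻¹ ^ m] i *
        (((localNonsplitEquiv (IsCMField.complexConj L) (qsForm L) (IsCMField.complexConj_ne_one L) w hw s :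
          ↥(unitaryGroupOfForm (galAdicCompletionMap (L := L) (IsCMField.complexConj L) hw) (placeForm (qsForm L) w.1))) :
          GL (Fin 3) (w.1.adicCompletion L)) : Matrix (Fin 3) (Fin 3) (w.1.adicCompletion L)) i i) := by
  -- one-place matrices are `w`-components of the `∏ L_w`-matrices (★ `coe_localNonsplitEquiv_eq_map`, definitional), and `ev_w` is a ring hom
  have hz' : (((z.val : GL (Fin 3) (LocalRing L v)) : Matrix (Fin 3) (Fin 3) (LocalRing L v)).map
      (Pi.evalRingHom (fun w' : PlacesOver L v => w'.1.adicCompletion L) w)) = β • (1 : Matrix (Fin 3) (Fin 3) (w.1.adicCompletion L)) := hz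
  have ha' : (((a.val : GL (Fin 3) (LocalRing L v)) : Matrix (Fin 3) (Fin 3) (LocalRing L v)).map
      (Pi.evalRingHom (fun w' : PlacesOver L v => w'.1.adicCompletion L) w)) =
      Matrix.diagonal ![α, 1, ((galAdicCompletionMap (L := L) (IsCMField.complexConj L) hw) α)⁻¹] := ha
  rw [coe_localNonsplitEquiv_eq_map, coe_localNonsplitEquiv_eq_map, Subgroup.coe_mul, Subgroup.coe_mul, Subgroup.coe_pow, Units.val_mul, Units.val_mul,
    Units.val_pow_eq_pow_val, Matrix.map_mul, Matrix.map_mul, Matrix.map_pow, hz', ha', F0P3cStCharTSShellOrientation.diagonal_three_pow, smul_mul_assoc,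
    one_mul, smul_mul_assoc, Matrix.smul_apply, smul_eq_mul, Matrix.diagonal_mul]

/-- **`E₃`-DIAGONAL ON THE `hlevi` STRATUM**: for `γ_H = (diag(d′₀, d′₁), u)` the one-place matrix of `ι_v(γ_H)` has diagonal `((d′₀)_w, ·, (d′₁)_w)` — entry `0 0`. (★
`endoEmbLocal_eq_glDiagonal_of_fst_eq`, ★ `coe_localNonsplitEquiv_eq_map`.) [cite: Rogawski1990, §4.8 Case (a) p. 53; §4.9 p. 55] -/
theorem localNonsplitEquiv_endoEmbLocal_apply_zero
    (γH : ((cmDatum L 2 (Matrix.of fun i j : Fin 2 => if i.val + j.val + 1 = 2 then (1 : L) else 0)).Local v ×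
      (cmDatum L 1 (Matrix.of fun i j : Fin 1 => if i.val + j.val + 1 = 1 then (1 : L) else 0)).Local v))
    {d' : Fin 2 → (LocalRing L v)ˣ} (hd' : glDiagonal 2 (LocalRing L v) d' = ((γH.1).val : GL (Fin 2) (LocalRing L v))) :
    (((localNonsplitEquiv (IsCMField.complexConj L) (qsForm L) (IsCMField.complexConj_ne_one L) w hw (endoEmbLocal L v γH) :
        ↥(unitaryGroupOfForm (galAdicCompletionMap (L := L) (IsCMField.complexConj L) hw) (placeForm (qsForm L) w.1))) :
        GL (Fin 3) (w.1.adicCompletion L)) : Matrix (Fin 3) (Fin 3) (w.1.adicCompletion L)) 0 0 = ((d' 0 : (LocalRing L v)ˣ) : LocalRing L v) w := by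
  rw [coe_localNonsplitEquiv_eq_map, endoEmbLocal_eq_glDiagonal_of_fst_eq L v γH hd', Matrix.map_apply, coe_glDiagonal, Matrix.diagonal_apply_eq]
  rfl

/-- … and entry `2 2` is `(d′₁)_w`. [cite: Rogawski1990, §4.8 Case (a) p. 53; §4.9 p. 55] -/
theorem localNonsplitEquiv_endoEmbLocal_apply_two
    (γH : ((cmDatum L 2 (Matrix.of fun i j : Fin 2 => if i.val + j.val + 1 = 2 then (1 : L) else 0)).Local v ×
      (cmDatum L 1 (Matrix.of fun i j : Fin 1 => if i.val + j.val + 1 = 1 then (1 : L) else 0)).Local v))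
    {d' : Fin 2 → (LocalRing L v)ˣ} (hd' : glDiagonal 2 (LocalRing L v) d' = ((γH.1).val : GL (Fin 2) (LocalRing L v))) :
    (((localNonsplitEquiv (IsCMField.complexConj L) (qsForm L) (IsCMField.complexConj_ne_one L) w hw (endoEmbLocal L v γH) :
        ↥(unitaryGroupOfForm (galAdicCompletionMap (L := L) (IsCMField.complexConj L) hw) (placeForm (qsForm L) w.1))) :
        GL (Fin 3) (w.1.adicCompletion L)) : Matrix (Fin 3) (Fin 3) (w.1.adicCompletion L)) 2 2 = ((d' 1 : (LocalRing L v)ˣ) : LocalRing L v) w := by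
  rw [coe_localNonsplitEquiv_eq_map, endoEmbLocal_eq_glDiagonal_of_fst_eq L v γH hd', Matrix.map_apply, coe_glDiagonal, Matrix.diagonal_apply_eq]
  rfl

/-! ## §2 The anti-oriented shell misses the `hlevi` stratum (`horient`); the flipped shell is oriented (sanity) -/

/-- **THE RAY `z·a^m·K_n` IS ANTI-ORIENTED FOR `hlevi`**: if `ι_v(γ_H) = z a^m s` with `s ∈ K_n` (level `r < 1` at `w`), `γ_H = (diag(d′₀, d′₁), u)`, then the stratum's
side condition `|(d′₁)_w|_w < |(d′₀)_w|_w` FAILS: `(d′₀)_w = β αᵐ k₀₀`, `(d′₁)_w = β (σ_w α)⁻ᵐ k₂₂` with `|β| = |kᵢᵢ| = 1`, `|α| < 1`, `m ≥ 1` (★ ORIENT `not_v_ray_last_lt_fst`).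
[cite: Rogawski1990, §4.9 Lemma 4.9.2, (4.9.4) p. 56; §12.7 L. 12.7.3 (proof) p. 195] [cite: Casselman1995, §1.4] -/
theorem valued_not_lt_of_endoEmbLocal_eq_ray_mul
    (Kn : Subgroup ↥(unitaryGroupOfForm (conjLocal L (IsCMField.complexConj L) v) (cmLocalForm L 3 v))) {r : WithZero (Multiplicative ℤ)} (hr : r < 1)
    (hK : ∀ k ∈ Kn, ∀ i j, Valued.v ((((localNonsplitEquiv (IsCMField.complexConj L) (qsForm L) (IsCMField.complexConj_ne_one L) w hw k :
        ↥(unitaryGroupOfForm (galAdicCompletionMap (L := L) (IsCMField.complexConj L) hw) (placeForm (qsForm L) w.1))) :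
        GL (Fin 3) (w.1.adicCompletion L)) : Matrix (Fin 3) (Fin 3) (w.1.adicCompletion L)) i j - (1 : Matrix (Fin 3) (Fin 3) (w.1.adicCompletion L)) i j) ≤ r)
    {z a : ↥(unitaryGroupOfForm (conjLocal L (IsCMField.complexConj L) v) (cmLocalForm L 3 v))} {β α : w.1.adicCompletion L}
    (hz : (((localNonsplitEquiv (IsCMField.complexConj L) (qsForm L) (IsCMField.complexConj_ne_one L) w hw z :
        ↥(unitaryGroupOfForm (galAdicCompletionMap (L := L) (IsCMField.complexConj L) hw) (placeForm (qsForm L) w.1))) :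
        GL (Fin 3) (w.1.adicCompletion L)) : Matrix (Fin 3) (Fin 3) (w.1.adicCompletion L)) = β • (1 : Matrix (Fin 3) (Fin 3) (w.1.adicCompletion L)))
    (hβ : Valued.v β = 1)
    (ha : (((localNonsplitEquiv (IsCMField.complexConj L) (qsForm L) (IsCMField.complexConj_ne_one L) w hw a :
        ↥(unitaryGroupOfForm (galAdicCompletionMap (L := L) (IsCMField.complexConj L) hw) (placeForm (qsForm L) w.1))) :
        GL (Fin 3) (w.1.adicCompletion L)) : Matrix (Fin 3) (Fin 3) (w.1.adicCompletion L)) =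
        Matrix.diagonal ![α, 1, ((galAdicCompletionMap (L := L) (IsCMField.complexConj L) hw) α)⁻¹])
    (hα0 : α ≠ 0) (hα1 : Valued.v α < 1) {m : ℕ} (hm : 1 ≤ m)
    {s : ↥(unitaryGroupOfForm (conjLocal L (IsCMField.complexConj L) v) (cmLocalForm L 3 v))} (hs : s ∈ Kn)
    (γH : ((cmDatum L 2 (Matrix.of fun i j : Fin 2 => if i.val + j.val + 1 = 2 then (1 : L) else 0)).Local v ×
      (cmDatum L 1 (Matrix.of fun i j : Fin 1 => if i.val + j.val + 1 = 1 then (1 : L) else 0)).Local v))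
    {d' : Fin 2 → (LocalRing L v)ˣ} (hd' : glDiagonal 2 (LocalRing L v) d' = ((γH.1).val : GL (Fin 2) (LocalRing L v)))
    (ht : (z * a ^ m * s : ↥(unitaryGroupOfForm (conjLocal L (IsCMField.complexConj L) v) (cmLocalForm L 3 v))) = endoEmbLocal L v γH) :
    ¬ Valued.v (((d' 1 : (LocalRing L v)ˣ) : LocalRing L v) w) < Valued.v (((d' 0 : (LocalRing L v)ˣ) : LocalRing L v) w) := by
  have h0 := localNonsplitEquiv_endoEmbLocal_apply_zero L v w hw γH hd'
  have h2 := localNonsplitEquiv_endoEmbLocal_apply_two L v w hw γH hd'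
  rw [← ht, localNonsplitEquiv_ray_mul_apply L v w hw hz ha m s] at h0 h2
  simp only [Matrix.cons_val_zero, Matrix.cons_val_two, Matrix.tail_cons, Matrix.head_cons] at h0 h2
  rw [← h0, ← h2, ← mul_assoc, ← mul_assoc]
  have hzβ : Valued.v β ≠ 0 := by rw [hβ]; exact one_ne_zero
  have hσ : Valued.v (galAdicCompletionMap (L := L) (IsCMField.complexConj L) hw α) = Valued.v α := by simp only [valued_galAdicCompletionMap]
  exact F0P3cStCharTSShellOrientation.not_v_ray_last_lt_fst Valued.v (galAdicCompletionMap (L := L) (IsCMField.complexConj L) hw) hzβ hσ hα0 hα1 hm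
    (valued_diag_eq_one_of_mem_level L v w hw Kn hr hK hs 0) (valued_diag_eq_one_of_mem_level L v w hw Kn hr hK hs 1)
    (valued_diag_eq_one_of_mem_level L v w hw Kn hr hK hs 2)

/-- **«HORIENT★» — KIT-B's `horient` clause for the anti-oriented shell `B₁ = {t ∈ T₃ | b⁻¹t ∈ C}`, `b = z·a^m`, `C = {k ∈ T₃ | k ∈ K_n}`**, in the exact binder shape of
★ `hc_of_cosetSum` (`γ_H`, `d′`, `hd′`, `hreg`, `hlt`, `h01`, `t`, `ht`): along the hyperbolic `G`-regular diagonal-Levi stratum `t = ι_v(γ_H)` is NOT in `B₁` (else `t = b·s`, `s ∈ K_n`,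
and `valued_not_lt_of_endoEmbLocal_eq_ray_mul` contradicts `hlt`). [cite: Rogawski1990, §4.9 Lemma 4.9.2, (4.9.4) p. 56; §12.7 L. 12.7.3 (proof) p. 195] -/
theorem horient_antiShell
    (Kn : Subgroup ↥(unitaryGroupOfForm (conjLocal L (IsCMField.complexConj L) v) (cmLocalForm L 3 v))) {r : WithZero (Multiplicative ℤ)} (hr : r < 1)
    (hK : ∀ k ∈ Kn, ∀ i j, Valued.v ((((localNonsplitEquiv (IsCMField.complexConj L) (qsForm L) (IsCMField.complexConj_ne_one L) w hw k :
        ↥(unitaryGroupOfForm (galAdicCompletionMap (L := L) (IsCMField.complexConj L) hw) (placeForm (qsForm L) w.1))) :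
        GL (Fin 3) (w.1.adicCompletion L)) : Matrix (Fin 3) (Fin 3) (w.1.adicCompletion L)) i j - (1 : Matrix (Fin 3) (Fin 3) (w.1.adicCompletion L)) i j) ≤ r)
    {z a : ↥(unitaryGroupOfForm (conjLocal L (IsCMField.complexConj L) v) (cmLocalForm L 3 v))} {β α : w.1.adicCompletion L}
    (hz : (((localNonsplitEquiv (IsCMField.complexConj L) (qsForm L) (IsCMField.complexConj_ne_one L) w hw z :
        ↥(unitaryGroupOfForm (galAdicCompletionMap (L := L) (IsCMField.complexConj L) hw) (placeForm (qsForm L) w.1))) :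
        GL (Fin 3) (w.1.adicCompletion L)) : Matrix (Fin 3) (Fin 3) (w.1.adicCompletion L)) = β • (1 : Matrix (Fin 3) (Fin 3) (w.1.adicCompletion L)))
    (hβ : Valued.v β = 1)
    (ha : (((localNonsplitEquiv (IsCMField.complexConj L) (qsForm L) (IsCMField.complexConj_ne_one L) w hw a :
        ↥(unitaryGroupOfForm (galAdicCompletionMap (L := L) (IsCMField.complexConj L) hw) (placeForm (qsForm L) w.1))) :
        GL (Fin 3) (w.1.adicCompletion L)) : Matrix (Fin 3) (Fin 3) (w.1.adicCompletion L)) =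
        Matrix.diagonal ![α, 1, ((galAdicCompletionMap (L := L) (IsCMField.complexConj L) hw) α)⁻¹])
    (hα0 : α ≠ 0) (hα1 : Valued.v α < 1) {m : ℕ} (hm : 1 ≤ m) (hbM : z * a ^ m ∈ (cmBorelTriple L 3 v).M) :
    ∀ (γH : ((cmDatum L 2 (Matrix.of fun i j : Fin 2 => if i.val + j.val + 1 = 2 then (1 : L) else 0)).Local v ×
        (cmDatum L 1 (Matrix.of fun i j : Fin 1 => if i.val + j.val + 1 = 1 then (1 : L) else 0)).Local v))
      (d' : Fin 2 → (LocalRing L v)ˣ), glDiagonal 2 (LocalRing L v) d' = ((γH.1).val : GL (Fin 2) (LocalRing L v)) → IsLocalGRegular L v γH →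
      Valued.v (((d' 1 : (LocalRing L v)ˣ) : LocalRing L v) w) < Valued.v (((d' 0 : (LocalRing L v)ˣ) : LocalRing L v) w) →
      galAdicCompletionMap (L := L) (IsCMField.complexConj L) hw (((d' 0 : (LocalRing L v)ˣ) : LocalRing L v) w) * ((d' 1 : (LocalRing L v)ˣ) : LocalRing L v) w = 1 →
      ∀ (t : ↥(cmBorelTriple L 3 v).M), (t : ↥(unitaryGroupOfForm (conjLocal L (IsCMField.complexConj L) v) (cmLocalForm L 3 v))) = endoEmbLocal L v γH →
      t ∉ {t : ↥(cmBorelTriple L 3 v).M | (⟨z * a ^ m, hbM⟩ : ↥(cmBorelTriple L 3 v).M)⁻¹ * t ∈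
        {k : ↥(cmBorelTriple L 3 v).M | (k : ↥(unitaryGroupOfForm (conjLocal L (IsCMField.complexConj L) v) (cmLocalForm L 3 v))) ∈ Kn}} := by
  intro γH d' hd' _ hlt _ t ht hmem
  simp only [Set.mem_setOf_eq] at hmem
  refine valued_not_lt_of_endoEmbLocal_eq_ray_mul L v w hw Kn hr hK hz hβ ha hα0 hα1 hm hmem γH hd' ?_ hlt
  rw [← ht, Subgroup.coe_mul, Subgroup.coe_inv, mul_inv_cancel_left]

/-- The same with the shell's membership read on the group `U(Φ₃)(L⁺_v)` (`(z a^m)⁻¹ · t ∈ K_n`), for consumers whose `C` is a preimage rather than a set-builder.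
[cite: Rogawski1990, §4.9 Lemma 4.9.2, (4.9.4) p. 56; §12.7 L. 12.7.3 (proof) p. 195] -/
theorem horient_antiShell'
    (Kn : Subgroup ↥(unitaryGroupOfForm (conjLocal L (IsCMField.complexConj L) v) (cmLocalForm L 3 v))) {r : WithZero (Multiplicative ℤ)} (hr : r < 1)
    (hK : ∀ k ∈ Kn, ∀ i j, Valued.v ((((localNonsplitEquiv (IsCMField.complexConj L) (qsForm L) (IsCMField.complexConj_ne_one L) w hw k :
        ↥(unitaryGroupOfForm (galAdicCompletionMap (L := L) (IsCMField.complexConj L) hw) (placeForm (qsForm L) w.1))) :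
        GL (Fin 3) (w.1.adicCompletion L)) : Matrix (Fin 3) (Fin 3) (w.1.adicCompletion L)) i j - (1 : Matrix (Fin 3) (Fin 3) (w.1.adicCompletion L)) i j) ≤ r)
    {z a : ↥(unitaryGroupOfForm (conjLocal L (IsCMField.complexConj L) v) (cmLocalForm L 3 v))} {β α : w.1.adicCompletion L}
    (hz : (((localNonsplitEquiv (IsCMField.complexConj L) (qsForm L) (IsCMField.complexConj_ne_one L) w hw z :
        ↥(unitaryGroupOfForm (galAdicCompletionMap (L := L) (IsCMField.complexConj L) hw) (placeForm (qsForm L) w.1))) :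
        GL (Fin 3) (w.1.adicCompletion L)) : Matrix (Fin 3) (Fin 3) (w.1.adicCompletion L)) = β • (1 : Matrix (Fin 3) (Fin 3) (w.1.adicCompletion L)))
    (hβ : Valued.v β = 1)
    (ha : (((localNonsplitEquiv (IsCMField.complexConj L) (qsForm L) (IsCMField.complexConj_ne_one L) w hw a :
        ↥(unitaryGroupOfForm (galAdicCompletionMap (L := L) (IsCMField.complexConj L) hw) (placeForm (qsForm L) w.1))) :
        GL (Fin 3) (w.1.adicCompletion L)) : Matrix (Fin 3) (Fin 3) (w.1.adicCompletion L)) =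
        Matrix.diagonal ![α, 1, ((galAdicCompletionMap (L := L) (IsCMField.complexConj L) hw) α)⁻¹])
    (hα0 : α ≠ 0) (hα1 : Valued.v α < 1) {m : ℕ} (hm : 1 ≤ m) :
    ∀ (γH : ((cmDatum L 2 (Matrix.of fun i j : Fin 2 => if i.val + j.val + 1 = 2 then (1 : L) else 0)).Local v ×
        (cmDatum L 1 (Matrix.of fun i j : Fin 1 => if i.val + j.val + 1 = 1 then (1 : L) else 0)).Local v))
      (d' : Fin 2 → (LocalRing L v)ˣ), glDiagonal 2 (LocalRing L v) d' = ((γH.1).val : GL (Fin 2) (LocalRing L v)) → IsLocalGRegular L v γH →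
      Valued.v (((d' 1 : (LocalRing L v)ˣ) : LocalRing L v) w) < Valued.v (((d' 0 : (LocalRing L v)ˣ) : LocalRing L v) w) →
      galAdicCompletionMap (L := L) (IsCMField.complexConj L) hw (((d' 0 : (LocalRing L v)ˣ) : LocalRing L v) w) * ((d' 1 : (LocalRing L v)ˣ) : LocalRing L v) w = 1 →
      ∀ (t : ↥(cmBorelTriple L 3 v).M), (t : ↥(unitaryGroupOfForm (conjLocal L (IsCMField.complexConj L) v) (cmLocalForm L 3 v))) = endoEmbLocal L v γH →
      (z * a ^ m)⁻¹ * (t : ↥(unitaryGroupOfForm (conjLocal L (IsCMField.complexConj L) v) (cmLocalForm L 3 v))) ∉ Kn := by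
  intro γH d' hd' _ hlt _ t ht hmem
  refine valued_not_lt_of_endoEmbLocal_eq_ray_mul L v w hw Kn hr hK hz hβ ha hα0 hα1 hm hmem γH hd' ?_ hlt
  rw [← ht, mul_inv_cancel_left]

/-- **SANITY (not load-bearing): THE WEYL-FLIPPED SHELL IS ORIENTED.**  If `E₃ b₂ = diag(β(σ_w α)⁻ᵐ, β, β αᵐ)` (the flip of `z a^m`) and `ι_v(γ_H) = b₂ s`, `s ∈ K_n`, then the
side condition `|(d′₁)_w| < |(d′₀)_w|` HOLDS (★ ORIENT `v_flip_snd_lt_flip_fst`). [cite: Rogawski1990, §4.9 Lemma 4.9.2 p. 56; §12.7 L. 12.7.3 (proof) p. 195] -/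
theorem valued_lt_of_endoEmbLocal_eq_flip_mul
    (Kn : Subgroup ↥(unitaryGroupOfForm (conjLocal L (IsCMField.complexConj L) v) (cmLocalForm L 3 v))) {r : WithZero (Multiplicative ℤ)} (hr : r < 1)
    (hK : ∀ k ∈ Kn, ∀ i j, Valued.v ((((localNonsplitEquiv (IsCMField.complexConj L) (qsForm L) (IsCMField.complexConj_ne_one L) w hw k :
        ↥(unitaryGroupOfForm (galAdicCompletionMap (L := L) (IsCMField.complexConj L) hw) (placeForm (qsForm L) w.1))) :
        GL (Fin 3) (w.1.adicCompletion L)) : Matrix (Fin 3) (Fin 3) (w.1.adicCompletion L)) i j - (1 : Matrix (Fin 3) (Fin 3) (w.1.adicCompletion L)) i j) ≤ r)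
    {b₂ : ↥(unitaryGroupOfForm (conjLocal L (IsCMField.complexConj L) v) (cmLocalForm L 3 v))} {β α : w.1.adicCompletion L} {m : ℕ}
    (hb₂ : (((localNonsplitEquiv (IsCMField.complexConj L) (qsForm L) (IsCMField.complexConj_ne_one L) w hw b₂ :
        ↥(unitaryGroupOfForm (galAdicCompletionMap (L := L) (IsCMField.complexConj L) hw) (placeForm (qsForm L) w.1))) :
        GL (Fin 3) (w.1.adicCompletion L)) : Matrix (Fin 3) (Fin 3) (w.1.adicCompletion L)) =
        Matrix.diagonal ![β * ((galAdicCompletionMap (L := L) (IsCMField.complexConj L) hw) α)⁻¹ ^ m, β, β * α ^ m])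
    (hβ : Valued.v β = 1) (hα0 : α ≠ 0) (hα1 : Valued.v α < 1) (hm : 1 ≤ m)
    {s : ↥(unitaryGroupOfForm (conjLocal L (IsCMField.complexConj L) v) (cmLocalForm L 3 v))} (hs : s ∈ Kn)
    (γH : ((cmDatum L 2 (Matrix.of fun i j : Fin 2 => if i.val + j.val + 1 = 2 then (1 : L) else 0)).Local v ×
      (cmDatum L 1 (Matrix.of fun i j : Fin 1 => if i.val + j.val + 1 = 1 then (1 : L) else 0)).Local v))
    {d' : Fin 2 → (LocalRing L v)ˣ} (hd' : glDiagonal 2 (LocalRing L v) d' = ((γH.1).val : GL (Fin 2) (LocalRing L v)))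
    (ht : (b₂ * s : ↥(unitaryGroupOfForm (conjLocal L (IsCMField.complexConj L) v) (cmLocalForm L 3 v))) = endoEmbLocal L v γH) :
    Valued.v (((d' 1 : (LocalRing L v)ˣ) : LocalRing L v) w) < Valued.v (((d' 0 : (LocalRing L v)ˣ) : LocalRing L v) w) := by
  have h0 := localNonsplitEquiv_endoEmbLocal_apply_zero L v w hw γH hd'
  have h2 := localNonsplitEquiv_endoEmbLocal_apply_two L v w hw γH hd'
  have hb₂' : (((b₂.val : GL (Fin 3) (LocalRing L v)) : Matrix (Fin 3) (Fin 3) (LocalRing L v)).map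
      (Pi.evalRingHom (fun w' : PlacesOver L v => w'.1.adicCompletion L) w)) =
      Matrix.diagonal ![β * ((galAdicCompletionMap (L := L) (IsCMField.complexConj L) hw) α)⁻¹ ^ m, β, β * α ^ m] := hb₂
  rw [← ht, coe_localNonsplitEquiv_eq_map, Subgroup.coe_mul, Units.val_mul, Matrix.map_mul, hb₂', Matrix.diagonal_mul] at h0 h2
  simp only [Matrix.cons_val_zero, Matrix.cons_val_two, Matrix.tail_cons, Matrix.head_cons] at h0 h2
  rw [← h0, ← h2]
  have hzβ : Valued.v β ≠ 0 := by rw [hβ]; exact one_ne_zero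
  have hσ : Valued.v (galAdicCompletionMap (L := L) (IsCMField.complexConj L) hw α) = Valued.v α := by simp only [valued_galAdicCompletionMap]
  -- the level-one entries of `s`, read in `ev_w`-coordinates (definitionally the `E₃`-coordinates)
  have hs0 : Valued.v ((((s.val : GL (Fin 3) (LocalRing L v)) : Matrix (Fin 3) (Fin 3) (LocalRing L v)).map
      (Pi.evalRingHom (fun w' : PlacesOver L v => w'.1.adicCompletion L) w)) 0 0) = 1 := valued_diag_eq_one_of_mem_level L v w hw Kn hr hK hs 0
  have hs1 : Valued.v ((((s.val : GL (Fin 3) (LocalRing L v)) : Matrix (Fin 3) (Fin 3) (LocalRing L v)).map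
      (Pi.evalRingHom (fun w' : PlacesOver L v => w'.1.adicCompletion L) w)) 1 1) = 1 := valued_diag_eq_one_of_mem_level L v w hw Kn hr hK hs 1
  have hs2 : Valued.v ((((s.val : GL (Fin 3) (LocalRing L v)) : Matrix (Fin 3) (Fin 3) (LocalRing L v)).map
      (Pi.evalRingHom (fun w' : PlacesOver L v => w'.1.adicCompletion L) w)) 2 2) = 1 := valued_diag_eq_one_of_mem_level L v w hw Kn hr hK hs 2
  exact F0P3cStCharTSShellOrientation.v_flip_snd_lt_flip_fst Valued.v (galAdicCompletionMap (L := L) (IsCMField.complexConj L) hw) hzβ hσ hα0 hα1 hm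
    hs2 hs1 hs0

end CM

end Summit.HodgeConjecture.HodgeConjecture.Cruxes.H413.F0P3cStCharTSHorient

end
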